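import Literature.NumberTheory.EllipticCurves.ArtinFormalismQuadraticRescueLocalProofs
import Literature.NumberTheory.EllipticCurves.AnalyticRankOverNumberFieldAbelianProofs
import HarnessLib

/-!
# `L(E/F, s)` is entire for `F ⊆ ℚ(ζ_m)`: the additive places rescued by a quadratic twist
# (towards `hasEntireLFunction_baseChange_fixedField`)

`Proofs` file (theorems only), continuing
`Literature.NumberTheory.EllipticCurves.AnalyticRankOverNumberFieldAbelianProofs`.  There the
named fact `hasEntireLFunction_baseChange_fixedField` (for every elliptic `E/ℚ`, `m ≥ 1` and
`H ≤ Gal(ℚ(ζ_m)/ℚ)`, `L(E/ℚ(ζ_m)^H, s)` is entire) was reduced to the modularity theorem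
`exists_isNewformOf` for all `E` having, above each of its non-semistable places `v`, only places
of additive reduction of `E_F` — automatic away from `m`, so a condition at the places `v ∣ m`
only.  At a place `v ∣ m` of additive reduction of `E` above which `E_F` turns semistable the
naive twists `∑ χ⋆(n) aₙ(E) n^{-s}` have the wrong Euler factor.  When the obstruction is
*quadratic* — `E` acquires semistable reduction at `v` after the quadratic twist by some `D` with
`√D ∈ ℚ(ζ_m)`, which covers every place of potentially multiplicative reduction and the places of
potentially good reduction with inertia acting through `±1` — the defect is repaired inside the
tree by trading `E` for `E' = E^{(D)}` (`W.quadraticTwist D`) and `χ` for `χψ_D`, `ψ_D` the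
quadratic Dirichlet character mod `m` of `ℚ(√D) ⊆ ℚ(ζ_m)`: `V_ℓ(E) ⊗ χ ≅ V_ℓ(E') ⊗ χψ_D`, and
the naive `(χψ_D)⋆`-twist of `L(E', s)` has the right Euler factor wherever `E'` is semistable.

* `WeierstrassCurve.intCoe_LFunction_baseChange_eq_prod_primitiveTwist_quadraticTwist_of_forall`
  — **Artin formalism through a quadratic twist.**  Let `L ⊇ ℚ` be an `m`-th cyclotomic field,
  `F ⊆ L` with character group `X(F)`, `θ ∈ L` with `θ² = D ∈ ℚˣ`, `ψ = ψ_D`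
  (`exists_dirichletCharacter_sqrt`) and `E/ℚ` elliptic such that `E_F` has additive reduction at
  every place above a place where `E' = E^{(D)}` is not semistable.  Then, as formal Dirichlet
  series, `L(E_F, s) = ∏_{χ ∈ X(F)} (χψ)⋆ • L(E', s)`: both sides are Euler products over the
  places `v` of `ℚ`, equal factor by factor by the local identity of
  `ArtinFormalismQuadraticRescueLocalProofs` where `E'` is semistable, and both `1` elsewhere.
* `WeierstrassCurve.hasEntireLFunction_baseChange_of_exists_isNewformOf_of_quadraticTwist_of_forall`
  — under the same hypothesis `L(E_F, s)` is entire, assuming `exists_isNewformOf` (applied to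
  `E'`; each `∑ (χψ)⋆(n) aₙ(E') n^{-s}` is the restriction of an entire function,
  `exists_differentiable_eq_LSeries_primitiveTwist_of_cuspCoeff_eq`, Shimura Thm. 3.66).
* `…_of_forall_mem` — the hypothesis is only needed at the places `v ∣ m`: away from `m` the
  field `ℚ(√D) ⊆ L` is unramified, so `E` and `E'` have the same reduction type
  (`localPolynomialAt_quadraticTwist_eq_or_of_natCast_not_mem`, from the relative quadratic
  Artin formalism `localPolynomialAt_baseChange_relQuadratic`: `L_v(E', T) = L_v(E, ±T)`), and
  additive reduction of `E` persists in `E_F` (`hasAdditiveReductionAt_baseChange_of_natCast_not_mem`).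
* `WeierstrassCurve.hasEntireLFunction_baseChange_fixedField_of_exists_isNewformOf_of_forall_mem_isSemistableAt_quadraticTwist`
  — **the named fact for every `E/ℚ` some quadratic twist `E^{(D)}` of which, `√D ∈ ℚ(ζ_m)`, is
  semistable at the primes dividing `m`**, modulo `exists_isNewformOf` (the case `D = 1` being
  `…_of_forall_mem_isSemistableAt` of the previous file).

This is the printed argument (Rohrlich 1997, §3.9–3.10: modularity, Artin formalism, and the
twisted `L`-functions `L(f ⊗ χ, s)`; at the rescued places the local factor of `f ⊗ χ⋆` is that
of the naive twist of the newform of `E^{(D)}` by `(χψ_D)⋆`, the elementary case of Carayol's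
local–global compatibility), carried out with the tree's inputs.  What remains of
`hasEntireLFunction_baseChange_fixedField` beyond modularity is confined to the places `v ∣ m` of
additive, potentially good reduction of `E` with inertia acting through a character of order
`3`, `4` or `6` that dies in `F`.

## References

* D. E. Rohrlich, *Modular curves, Hecke correspondences, and L-functions*, in: Modular Forms
  and Fermat's Last Theorem (1997), §3.9–3.10. [Rohrlich1997]
* C. Breuil, B. Conrad, F. Diamond, R. Taylor, JAMS 14 (2001), Thm. A. [BCDTJAMS2001]
* F. Diamond, J. Shurman, *A First Course in Modular Forms* (2005), Thm. 8.8.3. [DiamondShurman2005]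
* G. Shimura, *Introduction to the Arithmetic Theory of Automorphic Functions* (1971), Thm. 3.66.
  [Shimura1971]
* K. Ireland, M. Rosen, *A Classical Introduction to Modern Number Theory*, 2nd ed. (1990),
  Prop. 20.5.4. [IrelandRosen1990]
* J. H. Silverman, *The Arithmetic of Elliptic Curves*, 2nd ed. (2009), VII.5.4, X.5.4, §C.16.
  [SilvermanAEC2009]
-/

noncomputable section

open scoped Classical NumberField
open Filter Topology ArithmeticFunction IsDedekindDomain NumberField Polynomial IntermediateField
  Literature.NumberTheory.EllipticCurves Literature.NumberTheory.EllipticCurves.ModularForms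
  Literature.NumberTheory.GaloisRepresentations IsCyclotomicExtension.Rat

/-! ## Euler products (private copies of the `ArtinFormalismAbelianEulerProofs` lemmas) -/

namespace ArithmeticFunction

section EulerProduct

variable {ι : Type*}

/-- A family converging to `1` coefficientwise stays so after the coercion `ℤ → ℂ`. [folklore] -/
private theorem eventually_intCoe_apply_eq_one {f : ι → ArithmeticFunction ℤ}
    (hf : ∀ n, ∀ᶠ i in cofinite, f i n = (1 : ArithmeticFunction ℤ) n) (n : ℕ) :
    ∀ᶠ i in cofinite, (f i : ArithmeticFunction ℂ) n = (1 : ArithmeticFunction ℂ) n := by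
  filter_upwards [hf n] with i hi
  rw [intCoe_apply, hi, ← intCoe_apply, intCoe_one]

/-- Coercion `ℤ → ℂ` of a finite product of arithmetic functions. [folklore] -/
private theorem intCoe_finset_prod {α : Type*} (s : Finset α) (f : α → ArithmeticFunction ℤ) :
    ((∏ i ∈ s, f i : ArithmeticFunction ℤ) : ArithmeticFunction ℂ) =
      ∏ i ∈ s, (f i : ArithmeticFunction ℂ) := by
  induction s using Finset.induction_on with
  | empty => simp
  | insert a s ha ih => rw [Finset.prod_insert ha, Finset.prod_insert ha, intCoe_mul, ih]

/-- The coercion `ℤ → ℂ` commutes with Euler products (both are coefficientwise limits of the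
finite partial products). [folklore] -/
private theorem intCoe_eulerProduct (f : ι → ArithmeticFunction ℤ)
    (hf : ∀ n, ∀ᶠ i in cofinite, f i n = (1 : ArithmeticFunction ℤ) n) :
    ((eulerProduct f : ArithmeticFunction ℤ) : ArithmeticFunction ℂ) =
      eulerProduct fun i ↦ (f i : ArithmeticFunction ℂ) := by
  ext n
  obtain ⟨s, hs1, hs2⟩ := ((tendsTo_eulerProduct_of_tendsTo f hf n).and
    (tendsTo_eulerProduct_of_tendsTo _ (eventually_intCoe_apply_eq_one hf) n)).exists
  rw [intCoe_apply, ← hs1, ← hs2, ← intCoe_finset_prod, intCoe_apply]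

/-- A pointwise finite product of families converging to `1` coefficientwise converges to `1`
coefficientwise. [folklore] -/
private theorem eventually_finset_prod_apply_eq_one {R : Type*} [CommSemiring R] {α : Type*}
    (s : Finset α) (f : α → ι → ArithmeticFunction R)
    (hf : ∀ a ∈ s, ∀ n, ∀ᶠ i in cofinite, f a i n = (1 : ArithmeticFunction R) n) (n : ℕ) :
    ∀ᶠ i in cofinite, (∏ a ∈ s, f a i) n = (1 : ArithmeticFunction R) n := by
  have h : ∀ᶠ i in cofinite, ∀ a ∈ s, ∀ k ≤ n, f a i k = (1 : ArithmeticFunction R) k := by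
    rw [Finset.eventually_all]
    intro a ha
    have h' : ∀ k ∈ Finset.range (n + 1), ∀ᶠ i in cofinite,
        f a i k = (1 : ArithmeticFunction R) k := fun k _ ↦ hf a ha k
    rw [← Finset.eventually_all] at h'
    filter_upwards [h'] with i hi k hk
    exact hi k (Finset.mem_range.mpr (Nat.lt_succ_of_le hk))
  filter_upwards [h] with i hi
  exact finsetProd_apply_eq_one_apply_of_le s (fun a ↦ f a i) hi n le_rfl

/-- The Euler product of a pointwise finite product of families converging to `1` is the product
of the Euler products. [folklore] -/
private theorem eulerProduct_finset_prod {R : Type*} [CommSemiring R] {α : Type*} (s : Finset α)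
    (f : α → ι → ArithmeticFunction R)
    (hf : ∀ a ∈ s, ∀ n, ∀ᶠ i in cofinite, f a i n = (1 : ArithmeticFunction R) n) :
    eulerProduct (fun i ↦ ∏ a ∈ s, f a i) = ∏ a ∈ s, eulerProduct (f a) := by
  induction s using Finset.induction_on with
  | empty =>
    simp only [Finset.prod_empty]
    ext n
    obtain ⟨t, ht⟩ := (tendsTo_eulerProduct_of_tendsTo (fun _ : ι ↦ (1 : ArithmeticFunction R))
      (fun n ↦ Eventually.of_forall fun _ ↦ rfl) n).exists
    rw [← ht, Finset.prod_const_one]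
  | insert a s ha ih =>
    have hfa := hf a (Finset.mem_insert_self a s)
    have hfs : ∀ b ∈ s, ∀ n, ∀ᶠ i in cofinite, f b i n = (1 : ArithmeticFunction R) n :=
      fun b hb ↦ hf b (Finset.mem_insert_of_mem hb)
    simp only [Finset.prod_insert ha]
    rw [eulerProduct_mul_eq _ _ hfa (eventually_finset_prod_apply_eq_one s f hfs), ih hfs]

/-- The fibre products of a family converging to `1` coefficientwise, along a map with finite
fibres, converge to `1` coefficientwise. [folklore] -/
private theorem eventually_finprod_fiber_apply_eq_one {κ R : Type*} [CommSemiring R]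
    (f : ι → ArithmeticFunction R) (π : ι → κ) (hfib : ∀ k, {i | π i = k}.Finite)
    (hf : ∀ n, ∀ᶠ i in cofinite, f i n = (1 : ArithmeticFunction R) n) (n : ℕ) :
    ∀ᶠ k in cofinite, (∏ᶠ i ∈ {i | π i = k}, f i) n = (1 : ArithmeticFunction R) n := by
  have hB := finite_setOf_exists_apply_ne_one f hf n
  rw [eventually_cofinite]
  refine (hB.image π).subset fun k hk ↦ ?_
  by_contra hk'
  apply hk
  rw [finprod_mem_eq_finite_toFinset_prod _ (hfib k)]
  refine finsetProd_apply_eq_one_apply_of_le _ _ (fun i hi j hj ↦ ?_) n le_rfl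
  by_contra hij
  exact hk' ⟨i, ⟨j, hj, hij⟩, (hfib k).mem_toFinset.mp hi⟩

end EulerProduct

end ArithmeticFunction

namespace WeierstrassCurve

/-! ## Twists by primitive Dirichlet characters (private copies) -/

section PrimitiveTwist

variable {m : ℕ} (χ : DirichletCharacter ℂ m)

/-- `χ⋆(1) = 1`. [folklore] -/
private theorem primitive_map_one :
    (fun k : ℕ ↦ χ.primitiveCharacter (k : ZMod χ.conductor)) 1 = 1 := by
  simp only [Nat.cast_one, map_one]

/-- `χ⋆` is completely multiplicative on `ℕ`. [folklore] -/
private theorem primitive_map_mul (a b : ℕ) :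
    (fun k : ℕ ↦ χ.primitiveCharacter (k : ZMod χ.conductor)) (a * b) =
      (fun k : ℕ ↦ χ.primitiveCharacter (k : ZMod χ.conductor)) a *
        (fun k : ℕ ↦ χ.primitiveCharacter (k : ZMod χ.conductor)) b := by
  simp only [Nat.cast_mul, map_mul]

/-- The twist by `χ⋆` commutes with Euler products. [folklore] -/
private theorem primitiveTwist_eulerProduct {ι : Type*} (f : ι → ArithmeticFunction ℂ)
    (hf : ∀ n, ∀ᶠ i in cofinite, f i n = (1 : ArithmeticFunction ℂ) n) :
    (toArithmeticFunction fun k : ℕ ↦ χ.primitiveCharacter (k : ZMod χ.conductor)).pmul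
        (eulerProduct f) =
      eulerProduct fun i ↦
        (toArithmeticFunction fun k : ℕ ↦ χ.primitiveCharacter (k : ZMod χ.conductor)).pmul
          (f i) :=
  toArithmeticFunction_pmul_eulerProduct _ (primitive_map_one χ) (primitive_map_mul χ) f hf

/-- The twists by `χ⋆` of a family converging to `1` coefficientwise converge to `1`
coefficientwise. [folklore] -/
private theorem eventually_primitiveTwist_apply_eq_one {ι : Type*}
    {f : ι → ArithmeticFunction ℂ} (hf : ∀ n, ∀ᶠ i in cofinite, f i n = (1 : ArithmeticFunction ℂ) n)
    (n : ℕ) :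
    ∀ᶠ i in cofinite,
      (toArithmeticFunction fun k : ℕ ↦ χ.primitiveCharacter (k : ZMod χ.conductor)).pmul (f i) n =
        (1 : ArithmeticFunction ℂ) n :=
  eventually_toArithmeticFunction_pmul_apply_eq_one _ (primitive_map_one χ) hf n

end PrimitiveTwist

/-! ## `L`-series of finite products (private copy) -/

/-- `L`-series of a finite product of arithmetic functions with summable `L`-series: summable,
and equal to the product of the `L`-series (Mathlib `ArithmeticFunction.LSeries_mul'`, iterated).
[folklore] -/
private theorem LSeriesSummable_and_LSeries_finset_prod {α : Type*} (s : Finset α)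
    (f : α → ArithmeticFunction ℂ) (z : ℂ) (hf : ∀ a ∈ s, LSeriesSummable (⇑(f a)) z) :
    LSeriesSummable (⇑(∏ a ∈ s, f a)) z ∧
      LSeries (⇑(∏ a ∈ s, f a)) z = ∏ a ∈ s, LSeries (⇑(f a)) z := by
  induction s using Finset.induction_on with
  | empty =>
    simp only [Finset.prod_empty]
    have h1 : (⇑(1 : ArithmeticFunction ℂ) : ℕ → ℂ) = LSeries.delta :=
      ArithmeticFunction.one_eq_delta
    rw [h1, LSeries_delta, Pi.one_apply]
    refine ⟨summable_of_ne_finset_zero (s := {1}) fun n hn ↦ ?_, rfl⟩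
    rw [Finset.mem_singleton] at hn
    rw [LSeries.term_delta, if_neg hn]
  | insert a s ha ih =>
    have hfa := hf a (Finset.mem_insert_self a s)
    obtain ⟨hs1, hs2⟩ := ih fun b hb ↦ hf b (Finset.mem_insert_of_mem hb)
    rw [Finset.prod_insert ha, Finset.prod_insert ha]
    exact ⟨ArithmeticFunction.LSeriesSummable_mul hfa hs1,
      by rw [ArithmeticFunction.LSeries_mul' hfa hs1, hs2]⟩

/-! ## `[ℚ(√D) : ℚ] = 2` -/

section SqrtField

variable (L : Type) [Field L] [NumberField L]

/-- **`[ℚ(√D) : ℚ] = 2` for `√D ∉ ℚ`**: the minimal polynomial of `θ`, `θ² = D`, divides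
`X² - D` and is not linear. [folklore] -/
theorem _root_.Literature.NumberTheory.EllipticCurves.finrank_rat_adjoin_sqrt_eq_two {D : ℚ}
    {θ : L} (hθ : θ ^ 2 = algebraMap ℚ L D) (hθQ : θ ∉ Set.range (algebraMap ℚ L)) :
    Module.finrank ℚ (IntermediateField.adjoin ℚ ({θ} : Set L)) = 2 := by
  have hint : _root_.IsIntegral ℚ θ := Algebra.IsIntegral.isIntegral θ
  rw [IntermediateField.adjoin.finrank hint]
  have hroot : Polynomial.aeval θ (X ^ 2 - C D : ℚ[X]) = 0 := by
    simp only [map_sub, map_pow, aeval_X, aeval_C, hθ, sub_self]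
  have hdvd : minpoly ℚ θ ∣ X ^ 2 - C D := minpoly.dvd ℚ θ hroot
  have hmonic : (X ^ 2 - C D : ℚ[X]).Monic := monic_X_pow_sub_C D two_ne_zero
  have hdeg2 : (X ^ 2 - C D : ℚ[X]).natDegree = 2 := natDegree_X_pow_sub_C
  have hle : (minpoly ℚ θ).natDegree ≤ 2 := by
    rw [← hdeg2]
    exact natDegree_le_of_dvd hdvd hmonic.ne_zero
  have hne1 : (minpoly ℚ θ).natDegree ≠ 1 := by
    intro h1
    obtain ⟨x, hx⟩ := (minpoly.natDegree_eq_one_iff).mp h1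
    exact hθQ ⟨x, hx⟩
  have hpos : 0 < (minpoly ℚ θ).natDegree := minpoly.natDegree_pos hint
  omega

end SqrtField

/-! ## Away from `m`, the quadratic twist by `D`, `√D ∈ ℚ(ζ_m)`, has the reduction type of `E` -/

section AwayFromLevel

variable (W : WeierstrassCurve ℚ) [W.IsElliptic] {m : ℕ} [NeZero m] (L : Type) [Field L]
  [NumberField L] [hL : IsCyclotomicExtension {m} ℚ L]

include hL in
set_option maxHeartbeats 800000 in
/-- **`L_v(E^{(D)}, T) = L_v(E, ±T)` at a place `v ∤ m`, for `√D ∈ ℚ(ζ_m)`.**  Let `L ⊇ ℚ` be an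
`m`-th cyclotomic field, `θ ∈ L` with `θ² = D ∈ ℚˣ` and `v ∌ m` a finite place of `ℚ`.  If
`θ ∈ ℚ` then `E^{(D)} ≅ E` over `ℚ` (`exists_variableChange_smul_eq_quadraticTwist_sq`) and the
local polynomials agree (`localPolynomial_smul`).  Otherwise `M = ℚ(θ) ⊆ L` is quadratic and `v`
is unramified in `M` (`m` lies in the different of `L/ℚ`:
`ArtinLemma.isUnramifiedAt_of_isCyclotomicExtension`, `isUnramifiedIn_intermediateField`), so `v`
is split or inert in `M` (`placesOver_trichotomy_relQuadratic`) and the relative quadratic Artin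
formalism `localPolynomialAt_baseChange_relQuadratic` gives `L_v(E^{(D)}, T) = L_v(E, T)` (split)
or `L_v(E^{(D)}, T) = L_v(E, -T)` (inert).  (Silverman *AEC* VII.5.4 with X.5.4: a twist by an
unramified quadratic character does not change the reduction type.)
[cite: SilvermanAEC2009, VII.5.4 and §C.16 (PDF p. 390)] -/
theorem localPolynomialAt_quadraticTwist_eq_or_of_natCast_not_mem {D : ℚ} (hD0 : D ≠ 0)
    {θ : L} (hθ : θ ^ 2 = algebraMap ℚ L D) {v : HeightOneSpectrum (𝓞 ℚ)}
    (hmv : (m : 𝓞 ℚ) ∉ v.asIdeal) :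
    (W.quadraticTwist D).localPolynomialAt v = W.localPolynomialAt v ∨
      (W.quadraticTwist D).localPolynomialAt v = (W.localPolynomialAt v).comp (-X) := by
  by_cases hθQ : θ ∈ Set.range (algebraMap ℚ L)
  · /- `D` is a square in `ℚ`: `E^{(D)} ≅ E` over `ℚ` -/
    left
    obtain ⟨r, hr⟩ := hθQ
    have hr2 : r ^ 2 = D := by
      apply (algebraMap ℚ L).injective
      rw [map_pow, hr, hθ]
    have hr0 : r ≠ 0 := by
      rintro rfl
      apply hD0
      rw [← hr2]
      ring
    obtain ⟨C, hC⟩ := W.exists_variableChange_smul_eq_quadraticTwist_sq hr0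
    rw [← hr2, ← hC]
    change localPolynomial (v.adicCompletionIntegers ℚ) ((C • W).baseChange (v.adicCompletion ℚ)) =
      localPolynomial (v.adicCompletionIntegers ℚ) (W.baseChange (v.adicCompletion ℚ))
    rw [baseChange, baseChange, ← map_variableChange]
    exact localPolynomial_smul _ _ _
  · /- `θ ∉ ℚ`: the quadratic field `M = ℚ(θ) ⊆ L`, unramified at `v` -/
    set M : IntermediateField ℚ L := IntermediateField.adjoin ℚ ({θ} : Set L) with hMdef
    have h2 : Module.finrank ℚ M = 2 := finrank_rat_adjoin_sqrt_eq_two L hθ hθQ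
    set θ' : M := ⟨θ, IntermediateField.mem_adjoin_simple_self ℚ θ⟩ with hθ'def
    have hθ'2 : θ' ^ 2 = algebraMap ℚ M D := by
      apply Subtype.ext
      change θ ^ 2 = ((algebraMap ℚ M D : M) : L)
      rw [hθ]
      rfl
    have hθ'F : θ' ∉ Set.range (algebraMap ℚ M) := by
      rintro ⟨r, hr⟩
      apply hθQ
      refine ⟨r, ?_⟩
      have hr' : ((algebraMap ℚ M r : M) : L) = θ := congrArg Subtype.val hr
      rw [← hr']
      rfl
    -- every place of `M` above `v` is unramified
    have hunrL : Algebra.IsUnramifiedIn (𝓞 L) v.asIdeal := by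
      intro Q hQ hover
      haveI := hQ
      refine ArtinLemma.isUnramifiedAt_of_isCyclotomicExtension (L := ℚ) (m := m) Q fun h ↦ hmv ?_
      rw [hover.over, Ideal.under_def, Ideal.mem_comap, map_natCast]
      exact h
    have hunrM : Algebra.IsUnramifiedIn (𝓞 M) v.asIdeal :=
      ArtinLemma.isUnramifiedIn_intermediateField (F := ℚ) (M := L) M hunrL
    have he1 : ∀ w : HeightOneSpectrum (𝓞 M), w.asIdeal.under (𝓞 ℚ) = v.asIdeal →
        w.asIdeal.ramificationIdx (𝓞 ℚ) = 1 := by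
      intro w hw
      haveI : w.asIdeal.LiesOver v.asIdeal := ⟨hw.symm⟩
      haveI : Algebra.IsUnramifiedAt (𝓞 ℚ) w.asIdeal := hunrM w.asIdeal w.isPrime inferInstance
      exact Ideal.ramificationIdx_eq_one_of_isUnramifiedAt
    have hmem : ∀ {w : HeightOneSpectrum (𝓞 M)} {S : Set (HeightOneSpectrum (𝓞 M))},
        {w' : HeightOneSpectrum (𝓞 M) | w'.under (𝓞 ℚ) = v} = S → w ∈ S →
          w.asIdeal.under (𝓞 ℚ) = v.asIdeal := by
      intro w S hS hw
      rw [← hS] at hw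
      exact congrArg HeightOneSpectrum.asIdeal hw
    rcases placesOver_trichotomy_relQuadratic M h2 v with
      ⟨w₁, w₂, -, hset, hall⟩ | ⟨w, hset, he, hf⟩ | ⟨w, hset, he, -⟩
    · -- split
      have hw₁ : w₁ ∈ ({w₁, w₂} : Set (HeightOneSpectrum (𝓞 M))) := Set.mem_insert _ _
      have hw₁' := hmem hset hw₁
      rw [← hset] at hw₁
      obtain ⟨he, hf⟩ := hall w₁ hw₁
      exact Or.inl ((W.localPolynomialAt_baseChange_relQuadratic M h2 hD0 hθ'2 hθ'F hw₁').1 he hf).2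
    · -- inert
      have hw' := hmem hset (Set.mem_singleton w)
      exact Or.inr
        ((W.localPolynomialAt_baseChange_relQuadratic M h2 hD0 hθ'2 hθ'F hw').2.1 he hf).2
    · -- ramified: impossible away from `m`
      exfalso
      have hw' := hmem hset (Set.mem_singleton w)
      have h1 := he1 w hw'
      omega

include hL in
/-- **Away from `m`, `E^{(D)}` is semistable exactly where `E` is** (`√D ∈ ℚ(ζ_m)`): additive
reduction is read off `L_v = 1` (`localPolynomialAt_of_hasAdditiveReductionAt`,
`hasAdditiveReductionAt_of_localPolynomialAt_eq_one`) and `L_v(E^{(D)}, T) = L_v(E, ±T)`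
(`localPolynomialAt_quadraticTwist_eq_or_of_natCast_not_mem`).
[cite: SilvermanAEC2009, VII.5.4 and §C.16 (PDF p. 390)] -/
theorem not_isSemistableAt_of_quadraticTwist_of_natCast_not_mem {D : ℚ} (hD0 : D ≠ 0)
    {θ : L} (hθ : θ ^ 2 = algebraMap ℚ L D) {v : HeightOneSpectrum (𝓞 ℚ)}
    (hmv : (m : 𝓞 ℚ) ∉ v.asIdeal) (hv : ¬ (W.quadraticTwist D).IsSemistableAt v) :
    ¬ W.IsSemistableAt v := by
  haveI hEd : (W.quadraticTwist D).IsElliptic := W.isElliptic_quadraticTwist hD0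
  have hadd' : (W.quadraticTwist D).HasAdditiveReductionAt v := by
    by_contra h
    exact hv (((W.quadraticTwist D).isSemistableAt_iff_not_hasAdditiveReductionAt v).mpr h)
  have h1 : (W.quadraticTwist D).localPolynomialAt v = 1 :=
    localPolynomialAt_of_hasAdditiveReductionAt hadd'
  have hW1 : W.localPolynomialAt v = 1 := by
    rcases W.localPolynomialAt_quadraticTwist_eq_or_of_natCast_not_mem L hD0 hθ hmv with h | h
    · rw [← h, h1]
    · rw [h1] at h
      have h' : ((W.localPolynomialAt v).comp (-X)).comp (-X) = (1 : ℤ[X]).comp (-X) := by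
        rw [← h]
      rwa [comp_assoc, neg_comp, X_comp, neg_neg, comp_X, one_comp] at h'
  rw [W.isSemistableAt_iff_not_hasAdditiveReductionAt v, not_not]
  exact W.hasAdditiveReductionAt_of_localPolynomialAt_eq_one hW1

include hL in
/-- **Away from `m`, `E^{(D)}` is semistable at `v` iff `E` is** (`√D ∈ ℚ(ζ_m)`, `v ∤ m`): both
directions from `L_v(E^{(D)}, T) = L_v(E, ±T)`
(`localPolynomialAt_quadraticTwist_eq_or_of_natCast_not_mem`) and "additive iff `L_v = 1`".  With
`quadraticTwist_quadraticTwist` (`(E^{(D₁)})^{(D₂)} = E^{(D₁D₂)}`) this combines rescues at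
several primes: for `√D₂ ∈ ℚ(ζ_{m₂})`, `v ∤ m₂`, `E^{(D₁D₂)}` is semistable at `v` iff `E^{(D₁)}`
is. (Silverman *AEC* VII.5.4 with X.5.4.) [cite: SilvermanAEC2009, VII.5.4 and §C.16 (PDF p. 390)] -/
theorem isSemistableAt_quadraticTwist_iff_of_natCast_not_mem {D : ℚ} (hD0 : D ≠ 0)
    {θ : L} (hθ : θ ^ 2 = algebraMap ℚ L D) {v : HeightOneSpectrum (𝓞 ℚ)}
    (hmv : (m : 𝓞 ℚ) ∉ v.asIdeal) :
    (W.quadraticTwist D).IsSemistableAt v ↔ W.IsSemistableAt v := by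
  haveI hEd : (W.quadraticTwist D).IsElliptic := W.isElliptic_quadraticTwist hD0
  constructor
  · intro h
    by_contra hW
    have haddW : W.HasAdditiveReductionAt v := by
      by_contra h'
      exact hW ((W.isSemistableAt_iff_not_hasAdditiveReductionAt v).mpr h')
    have hW1 : W.localPolynomialAt v = 1 := localPolynomialAt_of_hasAdditiveReductionAt haddW
    have hD1 : (W.quadraticTwist D).localPolynomialAt v = 1 := by
      rcases W.localPolynomialAt_quadraticTwist_eq_or_of_natCast_not_mem L hD0 hθ hmv with h' | h'
      · rw [h', hW1]
      · rw [h', hW1, one_comp]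
    exact ((W.quadraticTwist D).isSemistableAt_iff_not_hasAdditiveReductionAt v).mp h
      ((W.quadraticTwist D).hasAdditiveReductionAt_of_localPolynomialAt_eq_one hD1)
  · intro h
    by_contra h'
    exact W.not_isSemistableAt_of_quadraticTwist_of_natCast_not_mem L hD0 hθ hmv h' h

end AwayFromLevel

/-! ## Artin formalism through a quadratic twist, as an identity of formal Euler products -/

section Global

variable (W : WeierstrassCurve ℚ) [W.IsElliptic] {m : ℕ} [NeZero m] (L : Type) [Field L]
  [NumberField L] [hL : IsCyclotomicExtension {m} ℚ L] (F : IntermediateField ℚ L)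

include hL in
set_option maxHeartbeats 800000 in
/-- **Artin formalism for `L(E_F, s)` through a quadratic twist, with primitive twists.**  Let
`L ⊇ ℚ` be an `m`-th cyclotomic field, `F ⊆ L` with character group `X(F)`, `θ ∈ L` with
`θ² = D ∈ ℚˣ`, `ψ` the quadratic Dirichlet character mod `m` of `θ` (`ψ(σ) = ±1` as `σθ = ±θ`,
`exists_dirichletCharacter_sqrt`), and `E/ℚ` an elliptic curve such that `E_F` has additive
reduction at every place above a place where the twist `E' = E^{(D)}` (`W.quadraticTwist D`) is
not semistable.  Then, as formal Dirichlet series over `ℂ`,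
`L(E_F) = ∏_{χ ∈ X(F)} (χψ)⋆ • L(E')`, `(χψ)⋆ • L(E') = ∑ (χψ)⋆(n) aₙ(E') n^{-s}` the twist by
the primitive character inducing `χψ`: both sides are Euler products over the places `v` of `ℚ`
whose factors agree where `E'` is semistable by the local identity
`intCoe_finprod_localEulerFactor_baseChange_eq_prod_primitiveTwist_of_quadraticTwist`, and are
`1` elsewhere (additive reduction of `E'` at `v` and of `E_F` above `v`).  (Ireland–Rosen
Prop. 20.5.4 (b) is the quadratic case `F = ℚ(√D)`, `E` semistable; Rohrlich 1997 §3.9 for the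
twisted Euler factors.) [cite: IrelandRosen1990, Ch. 20 §5, Prop. 20.5.4(b) (PDF p. 353)] -/
theorem intCoe_LFunction_baseChange_eq_prod_primitiveTwist_quadraticTwist_of_forall
    {D : ℚ} (hD0 : D ≠ 0) {θ : L} (hθ : θ ^ 2 = algebraMap ℚ L D)
    (ψ : DirichletCharacter ℂ m)
    (hψ1 : ∀ σ : L ≃ₐ[ℚ] L, σ θ = θ → ψ (galEquivZMod m L σ) = 1)
    (hψ2 : ∀ σ : L ≃ₐ[ℚ] L, σ θ = -θ → ψ (galEquivZMod m L σ) = -1)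
    (hadd : ∀ v : HeightOneSpectrum (𝓞 ℚ), ¬ (W.quadraticTwist D).IsSemistableAt v →
      ∀ w : HeightOneSpectrum (𝓞 F), w.asIdeal.under (𝓞 ℚ) = v.asIdeal →
        (W.baseChange F).HasAdditiveReductionAt w) :
    (((W.baseChange F).LFunction : ArithmeticFunction ℤ) : ArithmeticFunction ℂ) =
      ∏ χ ∈ ({χ | ∀ σ ∈ F.fixingSubgroup, χ (galEquivZMod m L σ) = 1} :
          Finset (DirichletCharacter ℂ m)),
        (toArithmeticFunction fun k : ℕ ↦
            (χ * ψ).primitiveCharacter (k : ZMod (χ * ψ).conductor)).pmul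
          (((W.quadraticTwist D).LFunction : ArithmeticFunction ℤ) : ArithmeticFunction ℂ) := by
  haveI hEd : (W.quadraticTwist D).IsElliptic := W.isElliptic_quadraticTwist hD0
  haveI : (W.baseChange F).IsElliptic := by rw [baseChange]; infer_instance
  set W' := W.quadraticTwist D with hW'
  -- convergence of the families of local factors
  have hΦc : ∀ n, ∀ᶠ v : HeightOneSpectrum (𝓞 ℚ) in cofinite,
      (W'.baseChange (v.adicCompletion ℚ)).localEulerFactor (v.adicCompletionIntegers ℚ) n =
        (1 : ArithmeticFunction ℤ) n :=
    W'.eventually_cofinite_localEulerFactor_apply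
  have hΦc' := eventually_intCoe_apply_eq_one hΦc
  have hΦFc : ∀ n, ∀ᶠ v : HeightOneSpectrum (𝓞 ℚ) in cofinite,
      (∏ᶠ w ∈ {w : HeightOneSpectrum (𝓞 F) | w.under (𝓞 ℚ) = v},
        ((W.baseChange F).baseChange (w.adicCompletion F)).localEulerFactor
          (w.adicCompletionIntegers F)) n = (1 : ArithmeticFunction ℤ) n :=
    eventually_finprod_fiber_apply_eq_one _ (fun w : HeightOneSpectrum (𝓞 F) ↦ w.under (𝓞 ℚ))
      (fun v ↦ v.finite_setOf_under_eq_of_numberField)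
      (W.baseChange F).eventually_cofinite_localEulerFactor_apply
  -- the right-hand side as one Euler product
  have hRHS : ∏ χ ∈ ({χ | ∀ σ ∈ F.fixingSubgroup, χ (galEquivZMod m L σ) = 1} :
      Finset (DirichletCharacter ℂ m)),
        (toArithmeticFunction fun k : ℕ ↦
            (χ * ψ).primitiveCharacter (k : ZMod (χ * ψ).conductor)).pmul
          ((W'.LFunction : ArithmeticFunction ℤ) : ArithmeticFunction ℂ) =
      eulerProduct fun v : HeightOneSpectrum (𝓞 ℚ) ↦
        ∏ χ ∈ ({χ | ∀ σ ∈ F.fixingSubgroup, χ (galEquivZMod m L σ) = 1} :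
            Finset (DirichletCharacter ℂ m)),
          (toArithmeticFunction fun k : ℕ ↦
              (χ * ψ).primitiveCharacter (k : ZMod (χ * ψ).conductor)).pmul
            (((W'.baseChange (v.adicCompletion ℚ)).localEulerFactor (v.adicCompletionIntegers ℚ) :
              ArithmeticFunction ℤ) : ArithmeticFunction ℂ) := by
    rw [W'.LFunction_eq_eulerProduct, intCoe_eulerProduct _ hΦc,
      eulerProduct_finset_prod _ (fun (χ : DirichletCharacter ℂ m) (v : HeightOneSpectrum (𝓞 ℚ)) ↦
        (toArithmeticFunction fun k : ℕ ↦
            (χ * ψ).primitiveCharacter (k : ZMod (χ * ψ).conductor)).pmul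
          (((W'.baseChange (v.adicCompletion ℚ)).localEulerFactor (v.adicCompletionIntegers ℚ) :
            ArithmeticFunction ℤ) : ArithmeticFunction ℂ))
        (fun χ _ n ↦ eventually_primitiveTwist_apply_eq_one (χ * ψ) hΦc' n)]
    exact Finset.prod_congr rfl fun χ _ ↦ primitiveTwist_eulerProduct (χ * ψ) _ hΦc'
  rw [(W.baseChange F).LFunction_eq_eulerProduct_finprod_under ℚ, intCoe_eulerProduct _ hΦFc, hRHS]
  congr 1
  funext v
  by_cases hv : W'.IsSemistableAt v
  · -- a semistable place of `E'`: the local identity through the twist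
    exact W.intCoe_finprod_localEulerFactor_baseChange_eq_prod_primitiveTwist_of_quadraticTwist
      L F hD0 hθ ψ hψ1 hψ2 v hv
  · -- additive reduction of `E'` at `v` and of `E_F` above `v`: both sides are `1`
    have hv' : W'.HasAdditiveReductionAt v := by
      by_contra h
      exact hv ((W'.isSemistableAt_iff_not_hasAdditiveReductionAt v).mpr h)
    have hL1 : ∏ᶠ w ∈ {w : HeightOneSpectrum (𝓞 F) | w.under (𝓞 ℚ) = v},
        ((W.baseChange F).baseChange (w.adicCompletion F)).localEulerFactor
          (w.adicCompletionIntegers F) = 1 := by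
      refine finprod_mem_of_eqOn_one fun w hw ↦ ?_
      have hw' : w.asIdeal.under (𝓞 ℚ) = v.asIdeal := congrArg HeightOneSpectrum.asIdeal hw
      change ((W.baseChange F).baseChange (w.adicCompletion F)).localEulerFactor
        (w.adicCompletionIntegers F) = 1
      rw [(W.baseChange F).localEulerFactor_baseChange_adicCompletion w,
        localPolynomialAt_of_hasAdditiveReductionAt (hadd v hv w hw'), Polynomial.coe_one,
        PowerSeries.invOfUnit_one_eq_of_mul_eq_one (map_one _) (mul_one 1), map_one]
    rw [hL1, intCoe_one]
    symm
    refine Finset.prod_eq_one fun χ _ ↦ ?_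
    have h1 := W'.prod_primitiveTwist_intCoe_localEulerFactor_eq_one_of_hasAdditiveReductionAt
      {χ * ψ} hv'
    rwa [Finset.prod_singleton] at h1

end Global

/-! ## `L(E_F, s)` is entire, modulo modularity, when a quadratic twist rescues the bad places -/

section Assembly

variable (W : WeierstrassCurve ℚ) [W.IsElliptic] (m : ℕ) [NeZero m] (L : Type) [Field L]
  [NumberField L] [hL : IsCyclotomicExtension {m} ℚ L] (F : IntermediateField ℚ L)

include hL in
/-- **`L(E/F, s)` is entire for `F ⊆ ℚ(ζ_m)`, modulo modularity, when `E_F` stays additive above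
the non-semistable places of a quadratic twist `E^{(D)}`, `√D ∈ ℚ(ζ_m)`.**  Assume
`exists_isNewformOf` (Diamond–Shurman Thm. 8.8.3; BCDT 2001, Thm. A).  Let `L ⊇ ℚ` be an `m`-th
cyclotomic field, `F ⊆ L`, `θ ∈ L` with `θ² = D ∈ ℚˣ`, and `E/ℚ` elliptic such that `E_F` has
additive reduction at every place above a place where `E^{(D)}` is not semistable.  Then
`L(E_F, s)` extends to an entire function: by the Artin formalism through the twist
(`intCoe_LFunction_baseChange_eq_prod_primitiveTwist_quadraticTwist_of_forall`)
`L(E_F, s) = ∏_{χ ∈ X(F)} ∑ (χψ_D)⋆(n) aₙ(E^{(D)}) n^{-s}` on `Re s > 3/2`, and each factor is the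
restriction of an entire function (`exists_differentiable_eq_LSeries_primitiveTwist_of_cuspCoeff_eq`
for the newform of `E^{(D)}`).  (Rohrlich 1997, §3.9–3.10: modularity, Artin formalism, twists.)
[cite: Rohrlich1997, §3.9–3.10] [cite: DiamondShurman2005, Thm. 8.8.3] -/
theorem hasEntireLFunction_baseChange_of_exists_isNewformOf_of_quadraticTwist_of_forall
    (hX : exists_isNewformOf) {D : ℚ} (hD0 : D ≠ 0) {θ : L} (hθ : θ ^ 2 = algebraMap ℚ L D)
    (hadd : ∀ v : HeightOneSpectrum (𝓞 ℚ), ¬ (W.quadraticTwist D).IsSemistableAt v →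
      ∀ w : HeightOneSpectrum (𝓞 F), w.asIdeal.under (𝓞 ℚ) = v.asIdeal →
        (W.baseChange F).HasAdditiveReductionAt w) :
    (W.baseChange F).HasEntireLFunction := by
  haveI hEd : (W.quadraticTwist D).IsElliptic := W.isElliptic_quadraticTwist hD0
  set W' := W.quadraticTwist D with hW'
  haveI : NeZero (W'.conductorNorm ℤ) := ⟨(W'.conductorNorm_pos_holds).ne'⟩
  obtain ⟨ψ, hψ1, hψ2⟩ := exists_dirichletCharacter_sqrt (m := m) L hD0 hθ
  obtain ⟨f, hf⟩ := hX W'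
  choose Lχ hLχd hLχeq using
    fun χ : DirichletCharacter ℂ m ↦
      W'.exists_differentiable_eq_LSeries_primitiveTwist_of_cuspCoeff_eq f hf.2 χ
  refine ⟨fun s ↦ ∏ χ ∈ ({χ | ∀ σ ∈ F.fixingSubgroup, χ (galEquivZMod m L σ) = 1} :
      Finset (DirichletCharacter ℂ m)), Lχ (χ * ψ) s, ?_, fun s hs ↦ ?_⟩
  · exact fun s ↦ DifferentiableAt.fun_finsetProd fun χ _ ↦ hLχd (χ * ψ) s
  · -- the `L`-series of the twists
    have htw : ∀ χ : DirichletCharacter ℂ m,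
        (⇑((toArithmeticFunction fun k : ℕ ↦ χ.primitiveCharacter (k : ZMod χ.conductor)).pmul
          ((W'.LFunction : ArithmeticFunction ℤ) : ArithmeticFunction ℂ)) : ℕ → ℂ) =
          fun n : ℕ ↦ χ.primitiveCharacter (n : ZMod χ.conductor) * ((W'.LFunction n : ℤ) : ℂ) := by
      intro χ
      funext n
      rw [toArithmeticFunction_pmul_apply, intCoe_apply]
    have htws : ∀ χ : DirichletCharacter ℂ m, LSeriesSummable
        (⇑((toArithmeticFunction fun k : ℕ ↦ χ.primitiveCharacter (k : ZMod χ.conductor)).pmul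
          ((W'.LFunction : ArithmeticFunction ℤ) : ArithmeticFunction ℂ))) s := by
      intro χ
      rw [htw]
      exact DirichletCharacter.LSeriesSummable_mul _ (W'.LSeriesSummable_of_lt_re_holds hs)
    -- Artin formalism through the twist, as an identity of `L`-series
    have hid := W.intCoe_LFunction_baseChange_eq_prod_primitiveTwist_quadraticTwist_of_forall
      (m := m) L F hD0 hθ ψ hψ1 hψ2 hadd
    have hcoe : ((↑) ∘ (W.baseChange F).LFunction : ℕ → ℂ) =
        ⇑(((W.baseChange F).LFunction : ArithmeticFunction ℤ) : ArithmeticFunction ℂ) := by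
      funext n
      rw [Function.comp_apply, intCoe_apply]
    simp only
    rw [Finset.prod_congr rfl fun χ _ ↦ hLχeq (χ * ψ) s hs, WeierstrassCurve.LSeries, hcoe, hid,
      (LSeriesSummable_and_LSeries_finset_prod _ _ s fun χ _ ↦ htws (χ * ψ)).2]
    exact Finset.prod_congr rfl fun χ _ ↦ by rw [htw]

include hL in
/-- **The same, with the hypothesis only at the places dividing `m`.**  Away from `m`, `ℚ(√D)`
is unramified, `E^{(D)}` is semistable exactly where `E` is
(`not_isSemistableAt_of_quadraticTwist_of_natCast_not_mem`) and additive reduction of `E`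
persists in `E_F` (`hasAdditiveReductionAt_baseChange_of_natCast_not_mem`).
[cite: Rohrlich1997, §3.9–3.10] [cite: DiamondShurman2005, Thm. 8.8.3] -/
theorem hasEntireLFunction_baseChange_of_exists_isNewformOf_of_quadraticTwist_of_forall_mem
    (hX : exists_isNewformOf) {D : ℚ} (hD0 : D ≠ 0) {θ : L} (hθ : θ ^ 2 = algebraMap ℚ L D)
    (hadd : ∀ v : HeightOneSpectrum (𝓞 ℚ), ¬ (W.quadraticTwist D).IsSemistableAt v →
      (m : 𝓞 ℚ) ∈ v.asIdeal →
      ∀ w : HeightOneSpectrum (𝓞 F), w.asIdeal.under (𝓞 ℚ) = v.asIdeal →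
        (W.baseChange F).HasAdditiveReductionAt w) :
    (W.baseChange F).HasEntireLFunction :=
  W.hasEntireLFunction_baseChange_of_exists_isNewformOf_of_quadraticTwist_of_forall m L F hX hD0
    hθ fun v hv w hw ↦
      if hmv : (m : 𝓞 ℚ) ∈ v.asIdeal then hadd v hv hmv w hw
      else W.hasAdditiveReductionAt_baseChange_of_natCast_not_mem L F hw
        (W.not_isSemistableAt_of_quadraticTwist_of_natCast_not_mem L hD0 hθ hmv hv) hmv

include hL in
/-- **`L(E/F, s)` is entire for `F ⊆ ℚ(ζ_m)` when a quadratic twist `E^{(D)}`, `√D ∈ ℚ(ζ_m)`,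
is semistable at the primes dividing `m` — modulo modularity.**  This is the quadratic rescue of
the additive places `v ∣ m` of `E`: every place of potentially multiplicative reduction and the
places of potentially good reduction with inertia acting through `±1`, whenever the twisting
field lies in `ℚ(ζ_m)` (Rohrlich 1997, §3.9–3.10; the local factors of `f ⊗ χ⋆` at such places
are those of the naive twists of the newform of `E^{(D)}`).
[cite: Rohrlich1997, §3.9–3.10] [cite: DiamondShurman2005, Thm. 8.8.3] -/
theorem hasEntireLFunction_baseChange_of_exists_isNewformOf_of_forall_mem_isSemistableAt_quadraticTwist
    (hX : exists_isNewformOf) {D : ℚ} (hD0 : D ≠ 0) {θ : L} (hθ : θ ^ 2 = algebraMap ℚ L D)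
    (hm : ∀ v : HeightOneSpectrum (𝓞 ℚ), (m : 𝓞 ℚ) ∈ v.asIdeal →
      (W.quadraticTwist D).IsSemistableAt v) :
    (W.baseChange F).HasEntireLFunction :=
  W.hasEntireLFunction_baseChange_of_exists_isNewformOf_of_quadraticTwist_of_forall_mem m L F hX
    hD0 hθ fun v hv hmv ↦ absurd (hm v hmv) hv

end Assembly

/-! ## The shape of `hasEntireLFunction_baseChange_fixedField` -/

section FixedField

variable (W : WeierstrassCurve ℚ) [W.IsElliptic] (m : ℕ) [NeZero m]
  (H : Subgroup (CyclotomicField m ℚ ≃ₐ[ℚ] CyclotomicField m ℚ))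

/-- **Towards `hasEntireLFunction_baseChange_fixedField`: the quadratic rescue.**  For `E/ℚ`
elliptic, `m ≥ 1`, `H ≤ Gal(ℚ(ζ_m)/ℚ)`, `F = ℚ(ζ_m)^H` and `θ ∈ ℚ(ζ_m)` with `θ² = D ∈ ℚˣ`: if
`E_F` has additive reduction above every place `v ∣ m` where `E^{(D)}` is not semistable, then
`L(E/F, s)` is entire — assuming `exists_isNewformOf`.  (What the named fact still needs beyond
modularity is thus confined to the places `v ∣ m` of additive, potentially good reduction of `E`
with inertia acting through a character of order `3`, `4` or `6` trivialised by `F`: Carayol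
1986; Rohrlich 1997, §3.9.) [cite: Rohrlich1997, §3.9–3.10] -/
theorem hasEntireLFunction_baseChange_fixedField_of_exists_isNewformOf_of_quadraticTwist_of_forall_mem
    (hX : exists_isNewformOf) {D : ℚ} (hD0 : D ≠ 0) {θ : CyclotomicField m ℚ}
    (hθ : θ ^ 2 = algebraMap ℚ (CyclotomicField m ℚ) D)
    (hadd : ∀ v : HeightOneSpectrum (𝓞 ℚ), ¬ (W.quadraticTwist D).IsSemistableAt v →
      (m : 𝓞 ℚ) ∈ v.asIdeal →
      ∀ w : HeightOneSpectrum (𝓞 ↥(IntermediateField.fixedField H)),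
        w.asIdeal.under (𝓞 ℚ) = v.asIdeal →
          (W.baseChange ↥(IntermediateField.fixedField H)).HasAdditiveReductionAt w) :
    (W.baseChange ↥(IntermediateField.fixedField H)).HasEntireLFunction :=
  haveI : IsCyclotomicExtension {m} ℚ (CyclotomicField m ℚ) :=
    CyclotomicField.isCyclotomicExtension m ℚ
  W.hasEntireLFunction_baseChange_of_exists_isNewformOf_of_quadraticTwist_of_forall_mem m
    (CyclotomicField m ℚ) (IntermediateField.fixedField H) hX hD0 hθ hadd

/-- **`hasEntireLFunction_baseChange_fixedField` for every `E/ℚ` with a quadratic twist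
`E^{(D)}`, `√D ∈ ℚ(ζ_m)`, semistable at the primes dividing `m` — modulo modularity**: for such
`E`, every `H ≤ Gal(ℚ(ζ_m)/ℚ)` has `L(E/ℚ(ζ_m)^H, s)` entire, assuming `exists_isNewformOf`
(Rohrlich 1997, §3.9–3.10 with BCDT Thm. A and Shimura Thm. 3.66; the case `D = 1` is
`hasEntireLFunction_baseChange_fixedField_of_exists_isNewformOf_of_forall_mem_isSemistableAt`).
[cite: Rohrlich1997, §3.9–3.10] -/
theorem hasEntireLFunction_baseChange_fixedField_of_exists_isNewformOf_of_forall_mem_isSemistableAt_quadraticTwist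
    (hX : exists_isNewformOf) {D : ℚ} (hD0 : D ≠ 0) {θ : CyclotomicField m ℚ}
    (hθ : θ ^ 2 = algebraMap ℚ (CyclotomicField m ℚ) D)
    (hm : ∀ v : HeightOneSpectrum (𝓞 ℚ), (m : 𝓞 ℚ) ∈ v.asIdeal →
      (W.quadraticTwist D).IsSemistableAt v) :
    (W.baseChange ↥(IntermediateField.fixedField H)).HasEntireLFunction :=
  W.hasEntireLFunction_baseChange_fixedField_of_exists_isNewformOf_of_quadraticTwist_of_forall_mem
    m H hX hD0 hθ fun v hv hmv ↦ absurd (hm v hmv) hv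

end FixedField

end WeierstrassCurve

end
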